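import Literature.IUT.HodgeArakelov.ThetaEvaluationModelEv
import Literature.IUT.HodgeArakelov.MonoThetaProjectiveThetaEnv
import Literature.IUT.HodgeArakelov.CohomologyLimitKummer
import Literature.IUT.HodgeArakelov.ConstantMultipleRigidity

/-!
# The theta-evaluation datum `(†×θ)(Π)` of [IUTchII] Cor. 1.12 AT THE MODEL `Π := Π^tp_{X̲̲}` — an instance of
# abc-iut-L6-t1's `ThetaEvaluation` over abc-iut-w4-d030's `θ_env`-data of the natural projective system

abc-iut cell, D-0067 wave 4 (seat abc-iut-w4-d043 gen 2; L6-lead ruling §F v1.18c (1) «GO d043 model-Ev»; SUBDAG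
`plan/L6/SUBDAG-IUTchII-Cor-112.md` rows Cor-112.0.r1 / Cor-112.ii.r13). S. Mochizuki, *Inter-universal Teichmüller
theory II*, kurims manuscript (Dec. 2020), Cor. 1.12 pp. 56–57, the diagram `(†×θ)(Π)`: (c) "one has a natural
inclusion `M^×_TM(Π) ↪ lim_J H¹(J, (l·Δ_Θ)(Π))`, hence a natural inclusion of `M^×_TM(Π)` into the inductive limit of
the first line", (ii) "restriction to the subgroup `D ⊆ Π_Ÿ(Π)`", (i) "`ι` induces an action up to torsion". Claim
key `Mochizuki2012` (D-0012, DISPUTED); this file is a CONSTRUCTION over landed files and asserts nothing of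
[IUTchII]; nothing here takes a side on [IUTchIII] Cor. 3.12.

THE INSTANCE `EtaleLevels.thetaEvaluation … : ThetaEvaluation T Env I` for
* `T :=` abc-iut-w4-d030's `EtaleLevels.thetaEnvData …` (p415224; its Prop. 1.4 output `T.D` is abc-iut-L6-t1's
  `etaleThetaDataOfSetting'`, whose cohomology system IS `cohomologySystemOfContH1 (phi C) (l·Δ_Θ) Π^tp_Ÿ̲̲` — REAL
  continuous cohomology), any Prop. 1.2 (i) output `Env` and any pointed inversion `I : PointedInversion Env T.D`
  (Rmk. 1.4.1 (ii); its decomposition group `I.Dmu ≤ Π_Ÿ(Π)`):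
* `Hd := lim_K H¹(D_{μ_-}|_K, (l·Δ_Θ)(Π))` (`h1Lim` at `I.Dmu`) — the target of "restriction to `D`" in which the unit
  classes live;
* `resD := h1LimRestrict` (abc-iut-L6-t1, p411724) along `I.Dmu ≤ Π_Ÿ(Π)`;
* `inclHd :=` the INFLATION SECTION `LevelRetraction.h1LimSection` of `resD` (abc-iut-w4-d043,
  `ThetaEvaluationModelEv.lean`) from level-retraction data `R` for `D_{μ_-} ≤ Π_Ÿ(Π)` (canonically
  `LevelRetraction.ofAugmentation` from the augmentation `Π ↠ G_k`, `ThetaEvaluationModelEvRetraction.lean`),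
  INJECTIVE (`h1LimSection_injective`) — print's "natural inclusion … into the inductive limit of the first line";
* `MxTM := M^×_TM(Π) :=` the image of the units `U = O^×_{k̄} ≤ k̄ˣ` under abc-iut-w4-d007's Kummer map INTO THE
  GENUINE LIMIT `h1LimKummer (phi C) (l·Δ_Θ) D_{μ_-} c` (p416543) — the Kummer map of the discrete rootable
  `Π`-module `k̄ˣ` with coefficients changed along the cyclotomic rigidity datum `c : μ_Ẑ(k̄) → (l·Δ_Θ)(Π)`
  (Cor. 1.11 (a)), here at the subgroup `D_{μ_-}`;
* `iotaLim := ρlim`, the action of `ι` on the limit (abc-iut-w5-d072's `pairRhoLim` = abc-iut-L6-t1's `h1LimAutEquiv`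
  for the model pointed-inversion pair, p416287; entered as the datum it is in CMR).
With this instance, the section identity `h1LimRestrict ∘ inclHd = id` (`LevelRetraction.h1LimRestrict_h1LimSection`)
IS the input `hsec` of abc-iut-w4-d043's `ThetaEvaluation.cor112_ii_of_section_of_pointedInversion` (p416319): the
Kummer-theoretic inputs `(hD₁)`/`(hD₂)` of Cor. 1.12 (ii) hold BY CONSTRUCTION at the model
(`EtaleLevels.thetaEvaluation_resD_inclHd`). Typed ≠ discharged for the remaining inputs (`hι`, `hμ`, the
Prop. 2.2 (ii) translate inputs, `hres`).
-/

noncomputable section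

namespace Literature.IUT.HodgeArakelov

open Literature.AnabelianGeometry.EtaleTheta Literature.AnabelianGeometry.SemiGraphs CohomologySystemOfContH1
open scoped Literature.AnabelianGeometry.EtaleTheta

namespace EtaleLevels

variable {p : ℕ} [Fact p.Prime] {D : Literature.AnabelianGeometry.EtaleTheta.ThetaSetting p}
  {E : D.EtaleThetaData} {l : ℕ} (C : E.DoubleUnderline l) (hC : D.Compat) (hS : D.Sec2Hyps)
  (hl : l.Prime) (hp2 : p ≠ 2) (hpl : p ≠ l) (hζ : ∃ ζ : D.K, IsPrimitiveRoot ζ (4 * l))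
  (mods : ∀ M : ℕ+, D.CyclotomeMod l M)
  (f : contCocycles D.toTheta D.DeltaTheta C.GtpYdduu) (hf : f ∈ C.rootCocycles hC)
  (hmods : ∀ (M M' : ℕ+) (h : (M : ℕ) ∣ (M' : ℕ)) (x : D.lDeltaTheta l),
    MuN.red p M M' h ((mods M').red x) = (mods M).red x)
  (h15 : Literature.AnabelianGeometry.EtaleTheta.ThetaSetting.Prop15iii E hC) (L : C.CuspLabels)
  (hZ : ∀ M : ℕ+, Nonempty (ModelCyclotomes.lDeltaQuot (C.rigidData (mods M) hC hS h15 L) ≃*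
    Literature.IUT.HodgeTheaters.ZHat))
  (hcharY : EtaleThetaDataOfSetting.PiYddCharacteristic C)
  (hlim : Function.Bijective (rigidLimHom C hC hS hl hp2 hpl hζ mods f hf hmods h15 L hZ))

variable (Env : EnvOfGroup (setting C hC hS hl hp2 hpl hζ mods f hf)
    (modelSystem C hC hS hl hp2 hpl hζ mods f hf hmods h15 L hZ).PiX)
  (I : PointedInversion Env (thetaEnvData C hC hS hl hp2 hpl hζ mods f hf hmods h15 L hZ hcharY hlim).D)
  (R : LevelRetraction (EtaleThetaDataOfSetting.phi C) (D.lDeltaTheta l) (EtaleThetaDataOfSetting.PiYdd C) I.Dmu)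
  {Aroot : Type} [CommGroup Aroot] [MulDistribMulAction (EtaleThetaDataOfSetting.Pi C) Aroot]
  [TopologicalSpace Aroot] [RootableBy Aroot ℕ]
  (c : CyclotomeCoefficients (EtaleThetaDataOfSetting.phi C) (D.lDeltaTheta l) Aroot)
  (hA : ∀ b : Aroot, IsOpen (MulAction.stabilizer (EtaleThetaDataOfSetting.Pi C) b :
    Set (EtaleThetaDataOfSetting.Pi C)))
  (hfi : ∀ b : Aroot, (MulAction.stabilizer (EtaleThetaDataOfSetting.Pi C) b).FiniteIndex)
  (U : Subgroup Aroot)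
  (ρlim : (EtaleThetaDataOfSetting.coh C).lim ≃+ (EtaleThetaDataOfSetting.coh C).lim)

/-- **The theta-evaluation datum `(†×θ)(Π)` at the model `Π := Π^tp_{X̲̲}`** (an instance of abc-iut-L6-t1's
`ThetaEvaluation` over `EtaleLevels.thetaEnvData`): `Hd := lim_K H¹(D_{μ_-}|_K, (l·Δ_Θ)(Π))`, `resD :=` restriction
to `D_{μ_-}` (`h1LimRestrict`), `inclHd :=` the inflation section of the level retractions `R` (injective),
`MxTM :=` the image of the units `U ≤ k̄ˣ` under the Kummer map into the genuine limit at `D_{μ_-}` (coefficients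
`(l·Δ_Θ)(Π)` via the cyclotomic rigidity datum `c`), `iotaLim := ρlim`. (c), (ii), (i) of Cor. 1.12 pp. 56–57.
[claim: Mochizuki2012, status: disputed] (IUTchII §1 Cor 1.12, kurims pp.56-57) -/
def thetaEvaluation :
    ThetaEvaluation (thetaEnvData C hC hS hl hp2 hpl hζ mods f hf hmods h15 L hZ hcharY hlim) Env I where
  Hd := h1Lim (EtaleThetaDataOfSetting.phi C) (D.lDeltaTheta l) I.Dmu ⊥
  inclHd := R.h1LimSection
  inclHd_injective := R.h1LimSection_injective I.Dmu_le
  MxTM := AddSubgroup.toSubgroup.symm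
    (U.map (h1LimKummer (EtaleThetaDataOfSetting.phi C) (D.lDeltaTheta l) I.Dmu c hA hfi))
  resD := h1LimRestrict (EtaleThetaDataOfSetting.phi C) (D.lDeltaTheta l) I.Dmu_le ⊥
  iotaLim := ρlim

/-- `Hd` of the model datum is `lim_K H¹(D_{μ_-}|_K, (l·Δ_Θ)(Π))`. [claim: Mochizuki2012, status: disputed] (IUTchII §1 Cor 1.12, kurims p.56) -/
theorem thetaEvaluation_Hd :
    (thetaEvaluation C hC hS hl hp2 hpl hζ mods f hf hmods h15 L hZ hcharY hlim Env I R c hA hfi U ρlim).Hd =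
      h1Lim (EtaleThetaDataOfSetting.phi C) (D.lDeltaTheta l) I.Dmu ⊥ :=
  rfl

/-- `resD` of the model datum is restriction to `D_{μ_-}` on the limit. [claim: Mochizuki2012, status: disputed] (IUTchII §1 Cor 1.12 (ii), kurims p.57) -/
theorem thetaEvaluation_resD (x) :
    (thetaEvaluation C hC hS hl hp2 hpl hζ mods f hf hmods h15 L hZ hcharY hlim Env I R c hA hfi U ρlim).resD x =
      h1LimRestrict (EtaleThetaDataOfSetting.phi C) (D.lDeltaTheta l) I.Dmu_le ⊥ x :=
  rfl

/-- `inclHd` of the model datum is the inflation section. [claim: Mochizuki2012, status: disputed] (IUTchII §1 Cor 1.12, kurims p.56) -/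
theorem thetaEvaluation_inclHd (x) :
    (thetaEvaluation C hC hS hl hp2 hpl hζ mods f hf hmods h15 L hZ hcharY hlim Env I R c hA hfi U ρlim).inclHd x =
      R.h1LimSection x :=
  rfl

/-- `iotaLim` of the model datum is the supplied action `ρlim`. [claim: Mochizuki2012, status: disputed] (IUTchII §1 Cor 1.12 (i), kurims p.57) -/
theorem thetaEvaluation_iotaLim (x) :
    (thetaEvaluation C hC hS hl hp2 hpl hζ mods f hf hmods h15 L hZ hcharY hlim Env I R c hA hfi U ρlim).iotaLim x =
      ρlim x :=
  rfl

/-- Membership in `M^×_TM(Π)` of the model datum: the Kummer classes of the units `U`.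
[claim: Mochizuki2012, status: disputed] (IUTchII §1 Cor 1.12, kurims p.56) -/
theorem mem_thetaEvaluation_MxTM (y) :
    y ∈ (thetaEvaluation C hC hS hl hp2 hpl hζ mods f hf hmods h15 L hZ hcharY hlim Env I R c hA hfi U ρlim).MxTM ↔
      ∃ u ∈ U, h1LimKummer (EtaleThetaDataOfSetting.phi C) (D.lDeltaTheta l) I.Dmu c hA hfi u =
        Multiplicative.ofAdd y := by
  change Multiplicative.ofAdd y ∈ U.map _ ↔ _
  exact Subgroup.mem_map

/-- **`res_D ∘ inclHd = id` at the model** (the section identity of the inflation section): the unit-class inputs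
`(hD₁)`/`(hD₂)` of [IUTchII] Cor. 1.12 (ii) — "restriction to `D` … `→ M^×_TM(Π)`" on the unit classes — hold BY
CONSTRUCTION for the model datum, in the section form `hsec` of `ThetaEvaluation.cor112_ii_of_section_of_pointedInversion`.
[claim: Mochizuki2012, status: disputed] (IUTchII §1 Cor 1.12 (ii), kurims p.57) -/
theorem thetaEvaluation_resD_inclHd (m) :
    (thetaEvaluation C hC hS hl hp2 hpl hζ mods f hf hmods h15 L hZ hcharY hlim Env I R c hA hfi U ρlim).resD
      ((thetaEvaluation C hC hS hl hp2 hpl hζ mods f hf hmods h15 L hZ hcharY hlim Env I R c hA hfi U ρlim).inclHd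
        m) = m :=
  R.h1LimRestrict_h1LimSection I.Dmu_le m

end EtaleLevels

end Literature.IUT.HodgeArakelov
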